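import Mathlib.RingTheory.FormalGroup.Basic
import Mathlib.RingTheory.MvPowerSeries.Order
import HarnessLib

/-!
# A formal group law from a tower of compatible TRUNCATED laws: `F = lim F_n`, associativity and commutativity in the limit
# ([Tate 1967] §2.2, proof of Prop. 1; the truncation calculus is [Lazard 1955] §I Lemme 1)

Topic `Literature/RingTheory/FormalGroups`; namespace `Literature.RingTheory.FormalGroups`.  THEOREMS ONLY (no definition, no
named fact, no instance, no notation, no `sorry`); Mathlib's `MvPowerSeries.subst` ∕ `FormalGroup` only.  Cell `hodgecm-mathlib`, P6
«MOD programme», sub-desk F0P6d, sub-line 2 `Cruxes/HLiu418/Lines/F0_P6d_ConnectedBTDictionary.lean`, letter (HL-D)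
`ConnectedDimOneIsOModuleLaw`, strategy σ1 — the layer after ★ `MonogenicTowerCoordinates` (p844858): in compatible coordinates the
comultiplications of the layers `Γ(G_n) ≅ k[X]⧸(X^{N_n})` are TRUNCATED LAWS `F_n ∈ k[X,Y]⧸(X^{N_n}, Y^{N_n})`, compatible and
associative ∕ commutative BELOW THE BOX; this file turns such a tower into ONE Mathlib `FormalGroup`.  HC_CM is proved only modulo
the printed citations until rung 0 closes; nothing here is about HC.

THE PRINT.  [Tate1967] §2.2, proof of Prop. 1: the affine algebras `A_ν` of a connected `p`-divisible group form, in compatible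
coordinates, the truncation tower of a power-series ring, and the comultiplications define a (divisible, commutative) formal Lie
group in the limit.  [Lazard1955] §I Lemme 1: the coefficients of a composite `f(a)` of total degree `< N` only depend on the
coefficients of `f` and of the `aᵢ` of degree `< N` (arguments without constant term) — here in the form «below an exponent `d`».

MAIN STATEMENTS.  §1 TRUNCATION CALCULUS: `coeff_mul_congr_le`, `coeff_pow_congr_le`, `coeff_finsetProd_congr_le`,
`coeff_prod_pow_eq_zero_of_degree_lt`, **`coeff_subst_congr`** (`(f(a))_d = (f′(a′))_d` when `f ≡ f′` in degrees `≤ |d|` and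
`aᵢ ≡ a′ᵢ` below `d`; any index types, `σ` finite).  §2 LIMITS: `coeff_eq_of_boxCompatible`, **`existsUnique_of_boxCompatible`**
(a tower `F_{n+1} ≡ F_n` on the box `{d ∣ d i < N n}`, `N` non-decreasing unbounded, has a unique limit series).  §3 LAWS:
`constantCoeff_subst_pair_eq_zero`, **`exists_formalGroup_of_truncatedLaws`** (constant-free, unit linear coefficients, box-compatible,
ASSOCIATIVE BELOW THE BOX in the shape of Mathlib's `FormalGroup.assoc` ⇒ `∃ F : FormalGroup A` with `F ≡ F_n` on the `n`-th box),
**`exists_formalGroup_isComm_of_truncatedLaws`** (+ commutative below the box ⇒ `F.IsComm`), `formalGroup_eq_of_truncatedLaws`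
(uniqueness).  The `𝒪`-action ∕ bud version (★ `IsOModuleBud`, ★ `IsOModuleBud.congr`) is the sequel `FormalOModuleLawOfBuds`.

## References
* [Tate1967] J. T. Tate, *p-divisible groups*, Proc. Conf. Local Fields (Driebergen, 1966), Springer (1967) — §2.2, proof of Prop. 1.
* [Lazard1955] M. Lazard, *Sur les groupes de Lie formels à un paramètre*, Bull. SMF 83 (1955) — §I, Lemme 1.
* [Hazewinkel1978] M. Hazewinkel, *Formal Groups and Applications* (1978) — §1.1 (1.1.2), §5.7 (congruences mod degree).
-/

noncomputable section

namespace Literature.RingTheory.FormalGroups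

open _root_.MvPowerSeries (HasSubst subst coeff constantCoeff)

universe u

variable {A : Type u} [CommRing A]

/-! ## §1 Truncation calculus: coefficients of products and composites below an exponent -/

section Congr

variable {τ : Type*}

/-- Products respect agreement of coefficients below an exponent `d` (congruence «below `d`»). [cite: Lazard1955, §I Lemme 1] [cite: Hazewinkel1978, §5.7] -/
theorem coeff_mul_congr_le {g g' h h' : MvPowerSeries τ A} {d : τ →₀ ℕ}
    (hg : ∀ c ≤ d, coeff c g = coeff c g') (hh : ∀ c ≤ d, coeff c h = coeff c h') :
    ∀ c ≤ d, coeff c (g * h) = coeff c (g' * h') := by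
  classical
  intro c hc
  rw [MvPowerSeries.coeff_mul, MvPowerSeries.coeff_mul]
  refine Finset.sum_congr rfl fun ij hij => ?_
  have h1 : ij.1 ≤ c := by
    rw [Finset.mem_antidiagonal] at hij; rw [← hij]; exact le_self_add
  have h2 : ij.2 ≤ c := by
    rw [Finset.mem_antidiagonal] at hij; rw [← hij]; exact le_add_self
  rw [hg _ (h1.trans hc), hh _ (h2.trans hc)]

/-- Powers respect agreement of coefficients below an exponent. [cite: Lazard1955, §I Lemme 1] -/
theorem coeff_pow_congr_le {g g' : MvPowerSeries τ A} {d : τ →₀ ℕ} (hg : ∀ c ≤ d, coeff c g = coeff c g') (n : ℕ) :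
    ∀ c ≤ d, coeff c (g ^ n) = coeff c (g' ^ n) := by
  induction n with
  | zero => intro c _; rw [pow_zero, pow_zero]
  | succ n ih => intro c hc; rw [pow_succ, pow_succ]; exact coeff_mul_congr_le ih hg c hc

/-- Finite products respect agreement of coefficients below an exponent. [cite: Lazard1955, §I Lemme 1] -/
theorem coeff_finsetProd_congr_le {ι : Type*} (s : Finset ι) {g g' : ι → MvPowerSeries τ A} {d : τ →₀ ℕ}
    (hg : ∀ i ∈ s, ∀ c ≤ d, coeff c (g i) = coeff c (g' i)) :
    ∀ c ≤ d, coeff c (∏ i ∈ s, g i) = coeff c (∏ i ∈ s, g' i) := by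
  classical
  induction s using Finset.induction_on with
  | empty => intro c _; rw [Finset.prod_empty, Finset.prod_empty]
  | insert i s hi ih =>
    intro c hc
    rw [Finset.prod_insert hi, Finset.prod_insert hi]
    exact coeff_mul_congr_le (hg i (Finset.mem_insert_self i s))
      (ih fun j hj => hg j (Finset.mem_insert_of_mem hj)) c hc

variable {σ : Type*}

/-- The monomial `∏ₛ aₛ^{eₛ}` in constant-free series `aₛ` has order at least `|e|`: its coefficients below total degree `|e|` vanish.
[cite: Lazard1955, §I Lemme 1] -/
theorem coeff_prod_pow_eq_zero_of_degree_lt {a : σ → MvPowerSeries τ A} (ha : ∀ s, constantCoeff (a s) = 0)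
    (e : σ →₀ ℕ) {d : τ →₀ ℕ} (h : Finsupp.degree d < Finsupp.degree e) :
    coeff d (e.prod fun s n => a s ^ n) = 0 := by
  apply MvPowerSeries.coeff_of_lt_order
  rw [Finsupp.prod]
  refine lt_of_lt_of_le ?_ (MvPowerSeries.le_order_prod _ _)
  calc ((Finsupp.degree d : ℕ) : ℕ∞) < ((Finsupp.degree e : ℕ) : ℕ∞) := by exact_mod_cast h
    _ = ∑ s ∈ e.support, ((e s : ℕ) : ℕ∞) := by rw [Finsupp.degree_apply, Nat.cast_sum]
    _ ≤ ∑ s ∈ e.support, (a s ^ e s).order :=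
        Finset.sum_le_sum fun s _ => MvPowerSeries.le_order_pow_of_constantCoeff_eq_zero (e s) (ha s)

/-- **Coefficients of a composite below `d` only see coefficients below `d`.**  For substitutions `a`, `a′` by constant-free series
and series `f`, `f′`: if `f ≡ f′` on exponents of total degree `≤ |d|` and `aₛ ≡ a′ₛ` on exponents `≤ d`, then
`(f(a))_d = (f′(a′))_d` — Lazard's Lemme 1 read below a single exponent. [cite: Lazard1955, §I Lemme 1] [cite: Hazewinkel1978, §5.7] -/
theorem coeff_subst_congr [Finite σ] {a a' : σ → MvPowerSeries τ A} (ha : ∀ s, constantCoeff (a s) = 0)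
    (ha' : ∀ s, constantCoeff (a' s) = 0) {f f' : MvPowerSeries σ A} {d : τ →₀ ℕ}
    (hf : ∀ e : σ →₀ ℕ, Finsupp.degree e ≤ Finsupp.degree d → coeff e f = coeff e f')
    (haa : ∀ s, ∀ c ≤ d, coeff c (a s) = coeff c (a' s)) :
    coeff d (subst a f) = coeff d (subst a' f') := by
  rw [MvPowerSeries.coeff_subst (MvPowerSeries.hasSubst_of_constantCoeff_zero ha),
    MvPowerSeries.coeff_subst (MvPowerSeries.hasSubst_of_constantCoeff_zero ha')]
  refine finsum_congr fun e => ?_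
  by_cases he : Finsupp.degree e ≤ Finsupp.degree d
  · rw [hf e he]
    congr 1
    rw [Finsupp.prod, Finsupp.prod]
    exact coeff_finsetProd_congr_le e.support (fun s _ => coeff_pow_congr_le (haa s) (e s)) d le_rfl
  · rw [coeff_prod_pow_eq_zero_of_degree_lt ha e (not_le.mp he), coeff_prod_pow_eq_zero_of_degree_lt ha' e (not_le.mp he),
      smul_zero, smul_zero]

end Congr


/-! ## §2 A series from box-compatible truncations -/

section Limit

variable {σ : Type*}

/-- Box-compatibility propagates along the tower: for `n ≤ m`, `F_m ≡ F_n` on the box of size `N n`. [cite: Tate1967, §2.2 (proof of Prop. 1)] -/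
theorem coeff_eq_of_boxCompatible {N : ℕ → ℕ} (hmono : ∀ n, N n ≤ N (n + 1)) {Fn : ℕ → MvPowerSeries σ A}
    (hcompat : ∀ n (d : σ →₀ ℕ), (∀ i, d i < N n) → coeff d (Fn (n + 1)) = coeff d (Fn n))
    {n m : ℕ} (hnm : n ≤ m) (d : σ →₀ ℕ) (hd : ∀ i, d i < N n) : coeff d (Fn m) = coeff d (Fn n) := by
  have hN : Monotone N := monotone_nat_of_le_succ hmono
  induction m, hnm using Nat.le_induction with
  | base => rfl
  | succ m hnm ih => rw [hcompat m d fun i => lt_of_lt_of_le (hd i) (hN hnm), ih]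

/-- **A box-compatible tower of series has a unique limit**: if `F_{n+1} ≡ F_n` on the box `{d ∣ ∀ i, d i < N n}` with `N`
non-decreasing and unbounded, there is a unique `F` with `F ≡ F_n` on the `n`-th box for every `n` (`A⟦X⟧ = lim A[X]⧸(X^N)` in
several variables, coefficientwise). [cite: Tate1967, §2.2 (proof of Prop. 1)] -/
theorem existsUnique_of_boxCompatible {N : ℕ → ℕ} (hmono : ∀ n, N n ≤ N (n + 1)) (hN : ∀ m, ∃ n, m ≤ N n)
    (Fn : ℕ → MvPowerSeries σ A) (hcompat : ∀ n (d : σ →₀ ℕ), (∀ i, d i < N n) → coeff d (Fn (n + 1)) = coeff d (Fn n)) :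
    ∃! F : MvPowerSeries σ A, ∀ n (d : σ →₀ ℕ), (∀ i, d i < N n) → coeff d F = coeff d (Fn n) := by
  classical
  -- a level whose box contains `d`
  have hlev : ∀ d : σ →₀ ℕ, ∃ n, ∀ i, d i < N n := fun d => by
    obtain ⟨n, hn⟩ := hN (d.support.sup d + 1)
    refine ⟨n, fun i => lt_of_lt_of_le (Nat.lt_succ_of_le ?_) hn⟩
    by_cases hi : i ∈ d.support
    · exact Finset.le_sup hi
    · rw [Finsupp.notMem_support_iff.mp hi]; exact Nat.zero_le _
  choose ℓ hℓ using hlev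
  refine ⟨fun d => coeff d (Fn (ℓ d)), fun n d hd => ?_, fun G hG => ?_⟩
  · show coeff d (Fn (ℓ d)) = coeff d (Fn n)
    rw [← coeff_eq_of_boxCompatible hmono hcompat (le_max_right n (ℓ d)) d (hℓ d),
      coeff_eq_of_boxCompatible hmono hcompat (le_max_left n (ℓ d)) d hd]
  · ext d
    show coeff d G = coeff d (Fn (ℓ d))
    exact hG (ℓ d) d (hℓ d)

end Limit

/-! ## §3 The formal group law of a tower of truncated laws -/

section Law

/-- A constant-free series substituted into constant-free arguments is constant-free (Mathlib, repackaged for pairs). [cite: Hazewinkel1978, §1.1 (1.1.2)] -/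
theorem constantCoeff_subst_pair_eq_zero {τ : Type*} {f : MvPowerSeries (Fin 2) A} (hf : constantCoeff f = 0)
    {a b : MvPowerSeries τ A} (ha : constantCoeff a = 0) (hb : constantCoeff b = 0) : constantCoeff (subst ![a, b] f) = 0 := by
  have h : ∀ i, constantCoeff ((![a, b] : Fin 2 → MvPowerSeries τ A) i) = 0 := fun i => by fin_cases i <;> simpa
  exact MvPowerSeries.constantCoeff_subst_eq_zero (MvPowerSeries.hasSubst_of_constantCoeff_zero h) h hf

/-- **A `FormalGroup` from compatible truncated laws.**  Let `F_n ∈ A⟦X,Y⟧` be constant-free, with unit linear coefficients, box-compatible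
along a non-decreasing unbounded `N`, and ASSOCIATIVE BELOW THE BOX: the coefficients of `F_n(F_n(X,Y),Z)` and `F_n(X,F_n(Y,Z))`
agree at every exponent `d` with `d i < N n`.  Then the limit series is a one-dimensional formal group law `F` over `A` (Mathlib
`FormalGroup`) with `F ≡ F_n` on the `n`-th box.  (The law of a connected `p`-divisible group from its layers' comultiplications in
compatible coordinates.) [cite: Tate1967, §2.2 (proof of Prop. 1)] -/
theorem exists_formalGroup_of_truncatedLaws {N : ℕ → ℕ} (hmono : ∀ n, N n ≤ N (n + 1)) (hN : ∀ m, ∃ n, m ≤ N n)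
    (Fn : ℕ → MvPowerSeries (Fin 2) A)
    (hcompat : ∀ n (d : Fin 2 →₀ ℕ), (∀ i, d i < N n) → coeff d (Fn (n + 1)) = coeff d (Fn n))
    (h0 : ∀ n, constantCoeff (Fn n) = 0)
    (hX : ∀ n, 1 < N n → coeff (Finsupp.single 0 1) (Fn n) = 1)
    (hY : ∀ n, 1 < N n → coeff (Finsupp.single 1 1) (Fn n) = 1)
    (hassoc : ∀ n (d : Fin 3 →₀ ℕ), (∀ i, d i < N n) →
      coeff d (subst ![subst ![(MvPowerSeries.X 0 : MvPowerSeries (Fin 3) A), MvPowerSeries.X 1] (Fn n), MvPowerSeries.X 2]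
        (Fn n)) =
        coeff d (subst ![(MvPowerSeries.X 0 : MvPowerSeries (Fin 3) A),
          subst ![(MvPowerSeries.X 1 : MvPowerSeries (Fin 3) A), MvPowerSeries.X 2] (Fn n)] (Fn n))) :
    ∃ F : FormalGroup A, ∀ n (d : Fin 2 →₀ ℕ), (∀ i, d i < N n) → coeff d F.toPowerSeries = coeff d (Fn n) := by
  obtain ⟨F, hF, -⟩ := existsUnique_of_boxCompatible hmono hN Fn hcompat
  -- constant and linear coefficients
  obtain ⟨n₂, hn₂⟩ := hN 2
  have hF0 : constantCoeff F = 0 := by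
    rw [← MvPowerSeries.coeff_zero_eq_constantCoeff_apply, hF n₂ 0 (fun i => by simp; omega),
      MvPowerSeries.coeff_zero_eq_constantCoeff_apply, h0]
  have hF1 : coeff (Finsupp.single 0 1) F = 1 := by
    rw [hF n₂ _ (fun i => by fin_cases i <;> simp <;> omega), hX n₂ (by omega)]
  have hF2 : coeff (Finsupp.single 1 1) F = 1 := by
    rw [hF n₂ _ (fun i => by fin_cases i <;> simp <;> omega), hY n₂ (by omega)]
  -- `F ≡ F_m` on all exponents of degree `≤ D` as soon as `D < N m`
  have hagree : ∀ (m : ℕ) (D : ℕ), D < N m → ∀ e : Fin 2 →₀ ℕ, Finsupp.degree e ≤ D → coeff e F = coeff e (Fn m) :=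
    fun m D hD e he => hF m e fun i => lt_of_le_of_lt ((Finsupp.le_degree i e).trans he) hD
  have hXc : ∀ i : Fin 3, constantCoeff (MvPowerSeries.X i : MvPowerSeries (Fin 3) A) = 0 := fun i => MvPowerSeries.constantCoeff_X i
  refine ⟨⟨F, hF0, hF1, hF2, ?_⟩, hF⟩
  -- associativity, coefficient by coefficient, through a deep enough truncation
  ext d
  obtain ⟨m, hm⟩ := hN (Finsupp.degree d + 1)
  have hdm : Finsupp.degree d < N m := by omega
  have hbox : ∀ i, d i < N m := fun i => lt_of_le_of_lt (Finsupp.le_degree i d) hdm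
  -- every composite's `d`-coefficient is computed through `F_m`
  have hcongr : ∀ (u v u' v' : MvPowerSeries (Fin 3) A), constantCoeff u = 0 → constantCoeff v = 0 →
      constantCoeff u' = 0 → constantCoeff v' = 0 →
      (∀ c ≤ d, coeff c u = coeff c u') → (∀ c ≤ d, coeff c v = coeff c v') →
      coeff d (subst ![u, v] F) = coeff d (subst ![u', v'] (Fn m)) := by
    intro u v u' v' hu hv hu' hv' huu hvv
    have h1 : ∀ i, constantCoeff ((![u, v] : Fin 2 → MvPowerSeries (Fin 3) A) i) = 0 := fun i => by
      fin_cases i <;> simpa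
    have h2 : ∀ i, constantCoeff ((![u', v'] : Fin 2 → MvPowerSeries (Fin 3) A) i) = 0 := fun i => by
      fin_cases i <;> simpa
    refine coeff_subst_congr h1 h2 (fun e he => hagree m _ hdm e he) fun s c hc => ?_
    fin_cases s
    · exact huu c hc
    · exact hvv c hc
  -- inner composites agree with their truncated versions below `d`
  have hin01 : ∀ c ≤ d, coeff c (subst ![(MvPowerSeries.X 0 : MvPowerSeries (Fin 3) A), MvPowerSeries.X 1] F) =
      coeff c (subst ![(MvPowerSeries.X 0 : MvPowerSeries (Fin 3) A), MvPowerSeries.X 1] (Fn m)) := by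
    intro c hc
    have h1 : ∀ i, constantCoeff ((![MvPowerSeries.X 0, MvPowerSeries.X 1] : Fin 2 → MvPowerSeries (Fin 3) A) i) = 0 :=
      fun i => by fin_cases i <;> simp
    exact coeff_subst_congr h1 h1 (fun e he => hagree m _ hdm e (he.trans (Finsupp.degree_mono hc))) fun s c' _ => rfl
  have hin12 : ∀ c ≤ d, coeff c (subst ![(MvPowerSeries.X 1 : MvPowerSeries (Fin 3) A), MvPowerSeries.X 2] F) =
      coeff c (subst ![(MvPowerSeries.X 1 : MvPowerSeries (Fin 3) A), MvPowerSeries.X 2] (Fn m)) := by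
    intro c hc
    have h1 : ∀ i, constantCoeff ((![MvPowerSeries.X 1, MvPowerSeries.X 2] : Fin 2 → MvPowerSeries (Fin 3) A) i) = 0 :=
      fun i => by fin_cases i <;> simp
    exact coeff_subst_congr h1 h1 (fun e he => hagree m _ hdm e (he.trans (Finsupp.degree_mono hc))) fun s c' _ => rfl
  have hz01 : constantCoeff (subst ![(MvPowerSeries.X 0 : MvPowerSeries (Fin 3) A), MvPowerSeries.X 1] F) = 0 :=
    constantCoeff_subst_pair_eq_zero hF0 (hXc 0) (hXc 1)
  have hz01' : constantCoeff (subst ![(MvPowerSeries.X 0 : MvPowerSeries (Fin 3) A), MvPowerSeries.X 1] (Fn m)) = 0 :=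
    constantCoeff_subst_pair_eq_zero (h0 m) (hXc 0) (hXc 1)
  have hz12 : constantCoeff (subst ![(MvPowerSeries.X 1 : MvPowerSeries (Fin 3) A), MvPowerSeries.X 2] F) = 0 :=
    constantCoeff_subst_pair_eq_zero hF0 (hXc 1) (hXc 2)
  have hz12' : constantCoeff (subst ![(MvPowerSeries.X 1 : MvPowerSeries (Fin 3) A), MvPowerSeries.X 2] (Fn m)) = 0 :=
    constantCoeff_subst_pair_eq_zero (h0 m) (hXc 1) (hXc 2)
  calc coeff d (subst ![subst ![(MvPowerSeries.X 0 : MvPowerSeries (Fin 3) A), MvPowerSeries.X 1] F, MvPowerSeries.X 2] F)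
      = coeff d (subst ![subst ![(MvPowerSeries.X 0 : MvPowerSeries (Fin 3) A), MvPowerSeries.X 1] (Fn m),
          MvPowerSeries.X 2] (Fn m)) :=
        hcongr _ _ _ _ hz01 (hXc 2) hz01' (hXc 2) hin01 (fun c _ => rfl)
    _ = coeff d (subst ![(MvPowerSeries.X 0 : MvPowerSeries (Fin 3) A),
          subst ![(MvPowerSeries.X 1 : MvPowerSeries (Fin 3) A), MvPowerSeries.X 2] (Fn m)] (Fn m)) := hassoc m d hbox
    _ = coeff d (subst ![(MvPowerSeries.X 0 : MvPowerSeries (Fin 3) A),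
          subst ![(MvPowerSeries.X 1 : MvPowerSeries (Fin 3) A), MvPowerSeries.X 2] F] F) :=
        (hcongr _ _ _ _ (hXc 0) hz12 (hXc 0) hz12' (fun c _ => rfl) hin12).symm

/-- **… and it is COMMUTATIVE** when the truncated laws are commutative below the box (`F_n(X,Y) ≡ F_n(Y,X)`).
[cite: Tate1967, §2.2 (proof of Prop. 1)] -/
theorem exists_formalGroup_isComm_of_truncatedLaws {N : ℕ → ℕ} (hmono : ∀ n, N n ≤ N (n + 1)) (hN : ∀ m, ∃ n, m ≤ N n)
    (Fn : ℕ → MvPowerSeries (Fin 2) A)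
    (hcompat : ∀ n (d : Fin 2 →₀ ℕ), (∀ i, d i < N n) → coeff d (Fn (n + 1)) = coeff d (Fn n))
    (h0 : ∀ n, constantCoeff (Fn n) = 0)
    (hX : ∀ n, 1 < N n → coeff (Finsupp.single 0 1) (Fn n) = 1)
    (hY : ∀ n, 1 < N n → coeff (Finsupp.single 1 1) (Fn n) = 1)
    (hassoc : ∀ n (d : Fin 3 →₀ ℕ), (∀ i, d i < N n) →
      coeff d (subst ![subst ![(MvPowerSeries.X 0 : MvPowerSeries (Fin 3) A), MvPowerSeries.X 1] (Fn n), MvPowerSeries.X 2]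
        (Fn n)) =
        coeff d (subst ![(MvPowerSeries.X 0 : MvPowerSeries (Fin 3) A),
          subst ![(MvPowerSeries.X 1 : MvPowerSeries (Fin 3) A), MvPowerSeries.X 2] (Fn n)] (Fn n)))
    (hcomm : ∀ n (d : Fin 2 →₀ ℕ), (∀ i, d i < N n) →
      coeff d (Fn n) = coeff d (subst ![(MvPowerSeries.X 1 : MvPowerSeries (Fin 2) A), MvPowerSeries.X 0] (Fn n))) :
    ∃ F : FormalGroup A, F.IsComm ∧ ∀ n (d : Fin 2 →₀ ℕ), (∀ i, d i < N n) → coeff d F.toPowerSeries = coeff d (Fn n) := by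
  obtain ⟨F, hF⟩ := exists_formalGroup_of_truncatedLaws hmono hN Fn hcompat h0 hX hY hassoc
  refine ⟨F, ⟨?_⟩, hF⟩
  ext d
  obtain ⟨m, hm⟩ := hN (Finsupp.degree d + 1)
  have hdm : Finsupp.degree d < N m := by omega
  have hbox : ∀ i, d i < N m := fun i => lt_of_le_of_lt (Finsupp.le_degree i d) hdm
  have h1 : ∀ i, constantCoeff ((![MvPowerSeries.X 1, MvPowerSeries.X 0] : Fin 2 → MvPowerSeries (Fin 2) A) i) = 0 :=
    fun i => by fin_cases i <;> simp
  calc coeff d F.toPowerSeries = coeff d (Fn m) := hF m d hbox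
    _ = coeff d (subst ![(MvPowerSeries.X 1 : MvPowerSeries (Fin 2) A), MvPowerSeries.X 0] (Fn m)) := hcomm m d hbox
    _ = coeff d (subst ![(MvPowerSeries.X 1 : MvPowerSeries (Fin 2) A), MvPowerSeries.X 0] F.toPowerSeries) :=
        coeff_subst_congr h1 h1 (fun e he => (hF m e fun i => lt_of_le_of_lt ((Finsupp.le_degree i e).trans he) hdm).symm)
          fun s c _ => rfl

/-- **Uniqueness**: a formal group law is determined by its agreement with the truncated laws on all boxes.
[cite: Tate1967, §2.2 (proof of Prop. 1)] -/
theorem formalGroup_eq_of_truncatedLaws {N : ℕ → ℕ} (hN : ∀ m, ∃ n, m ≤ N n) (Fn : ℕ → MvPowerSeries (Fin 2) A)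
    {F G : FormalGroup A} (hF : ∀ n (d : Fin 2 →₀ ℕ), (∀ i, d i < N n) → coeff d F.toPowerSeries = coeff d (Fn n))
    (hG : ∀ n (d : Fin 2 →₀ ℕ), (∀ i, d i < N n) → coeff d G.toPowerSeries = coeff d (Fn n)) : F = G := by
  apply FormalGroup.ext
  ext d
  obtain ⟨m, hm⟩ := hN (Finsupp.degree d + 1)
  have hbox : ∀ i, d i < N m := fun i => lt_of_le_of_lt (Finsupp.le_degree i d) (by omega)
  rw [hF m d hbox, hG m d hbox]

end Law

end Literature.RingTheory.FormalGroups
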